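import Mathlib
import Literature.MathematicalPhysics.QuantumFieldTheory.Balaban1983to89.Beta.TorusG0Kernel
import Literature.MathematicalPhysics.QuantumFieldTheory.Balaban1983to89.Beta.WoodburyFibre

/-!
# β sub-cell, row an5 — BRIDGE: pv23's torus operator `torusOp` / Green matrix `G0` ARE King's `fineOp` / its inverse

HONEST FRAMING (BETA-SPEC §1, verbatim): «discharging BetaPertH makes Balaban's UV stability UNCONDITIONAL — a real
constructive-QFT result; it is NOT the continuum limit and NOT the Clay problem.»  ABSOLUTE RULE: no internally-minted
statement enters as a cited fact; everything below is kernel-proved from definitions already in the tree (Mathlib-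
elementary, tag [folklore]); nothing printed is asserted.

WHAT.  Two Lean objects for the same scalar block-averaged one-step operator `H = −Δ^η + a·Q*Q` on the fine torus
`Tor (fine (n+1) M)` live in the tree:
* pv23's `TorusG0Decay.torusOp n M a` (site basis: the graph Laplacian `CombesThomasForm.lap` of the nearest-neighbour
  coupling `(n+1)²` plus `Σ_b (a/|B(b)|)·1_{B(b)} ⊗ 1_{B(b)}` with `B5Blocks16.blockOf`), whose inverse is
  `TorusG0Kernel.G0 n M a` (the object of pv23's `ℓ²` / Combes–Thomas decay estimates and of an5-g4's `EffectiveKernel`);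
* King's `King1986.Torus.fineOp N M a c m2 = lapF (fine N M) c m2 + a • blockProj N M` (with `King1986.Torus.blockOf`),
  the object of the momentum-space (Bloch-fibre) analysis `Beta/WoodburyFibre` (exact decomposition + `O(N⁻⁴)` Woodbury
  correction bounds).
This file proves they are THE SAME MATRIX (periods `≥ 3`, the standing hypothesis of pv23's site-basis formula):
* `blockOf_eq_blockOf` : King's block map = B5's block map (both invert the same bijection `(b, j) ↦ L·b + j`,
  `site_eq_bpt`);
* `fineOp_mulVec` : the site-basis formula of King's operator (any periods, any `m2 = 0`... stated at `m2 = 0`);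
* `torusOp_eq_fineOp` : `torusOp n M a = fineOp (n+1) M a ((n+1)²) 0`;
* `G0_eq_fineOp_inv` : `G0 n M a = (fineOp (n+1) M a ((n+1)²) 0)⁻¹`;
* `G0_decomposition` : hence the massless exact decomposition (E₀) of `WoodburyFibre` holds VERBATIM for pv23's `G0`:
  `G0(x,x′) = GfreePerp (n+1) M 0 (x′ − x) + V⁻¹a⁻¹ − Rperp (n+1) M a 0 x x′` (`a > 0`), and in `d = 4` with equal periods
  the three Woodbury bounds `‖Rperp‖ ≤ woodburyD 0/(n+1)⁴`, differences `/ (n+1)⁵`, `/ (n+1)⁶` apply to the `G0` of the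
  exterior-decay files (`TorusG0Decay`, `CombesThomasKernelTail`) — ONE carrier for the window (W2′) and exterior (W3a)
  legs of the scalar model.  In lattice units (pv23's dictionary `Γ_L = L²·G0`, `L = n+1`) this is §8 of `WoodburyFibre`.

WHAT IT DOES NOT GIVE: anything beyond the identification — no new estimate; periods `≤ 2` excluded (there the two
site-basis conventions genuinely differ: `lapF` counts the wrapped neighbour twice); nothing about `C_k`, `β`, `κ`.

Authored in-session by `b2b-balaban-beta-an5-g5` (row BETA-an5 gen 5, node BETA-an5-WOODBURY-FIBRE); value = kernel
certificate (bookkeeping), NOT summit progress.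
-/

noncomputable section

open Finset Matrix
open scoped BigOperators ComplexConjugate

namespace Literature.MathematicalPhysics.QuantumFieldTheory.Balaban1983to89.Beta.WoodburyFibre

open King1986.Torus
open B5Prop11Plancherel (Tor fine unitVec)
open TorusG0Decay (torusOp torusOp_mulVec)
open TorusG0Kernel (G0)

variable {d : ℕ}

/-- two real matrices with the same action on every vector are equal. [folklore] -/
theorem eq_of_mulVec_eq {ι : Type*} [Fintype ι] [DecidableEq ι] {A B : Matrix ι ι ℝ}
    (h : ∀ f : ι → ℝ, A.mulVec f = B.mulVec f) : A = B := by
  ext i j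
  have hij := congrFun (h (Pi.single j 1)) i
  simpa [Matrix.mulVec, dotProduct, Pi.single_apply, mul_ite] using hij

section Bridge

variable (L : ℕ) [NeZero L] (M : Fin d → ℕ) [hM : ∀ μ, NeZero (M μ)]

/-- King's block map (`TorusBlockForm.blockOf`, inverting `(b,j) ↦ site b j`) equals B5's (`B5Blocks16.blockOf`,
inverting `(b,j) ↦ bpt b j`) — `site = bpt`. [folklore] -/
theorem blockOf_eq_blockOf (y : Tor (fine L M)) : King1986.Torus.blockOf L M y = B5Blocks16.blockOf L M y := by
  obtain ⟨⟨b, j⟩, rfl⟩ := (blockEquiv L M).surjective y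
  rw [blockEquiv_apply, blockOf_site, site_eq_bpt, B5Blocks16.blockOf_bpt]

/-- the Laplacian part of King's operator in the site basis:
`Σ_{z′} lapF(x,z′) f(z′) = 2dc·f(x) − c Σ_μ (f(x+e_μ) + f(x−e_μ))` (`m2 = 0`). [folklore] -/
theorem lapF_mulVec (K : Fin d → ℕ) [∀ μ, NeZero (K μ)] (c : ℝ) (f : Tor K → ℝ) (x : Tor K) :
    (lapF K c 0).mulVec f x
      = 2 * d * c * f x - c * ∑ μ : Fin d, (f (x + unitVec K μ) + f (x - unitVec K μ)) := by
  have hdiag : ∑ z' : Tor K, (2 * (d : ℝ) * c * (if z' = x then (1 : ℝ) else 0)) * f z' = 2 * d * c * f x := by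
    simp only [mul_ite, mul_one, mul_zero, ite_mul, zero_mul, Finset.sum_ite_eq', Finset.mem_univ, if_true]
  have hoff : ∑ z' : Tor K, (c * ∑ μ : Fin d, ((if z' = x + unitVec K μ then (1 : ℝ) else 0)
      + (if z' = x - unitVec K μ then (1 : ℝ) else 0))) * f z'
      = c * ∑ μ : Fin d, (f (x + unitVec K μ) + f (x - unitVec K μ)) := by
    calc ∑ z' : Tor K, (c * ∑ μ : Fin d, ((if z' = x + unitVec K μ then (1 : ℝ) else 0)
            + (if z' = x - unitVec K μ then (1 : ℝ) else 0))) * f z'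
        = c * ∑ z' : Tor K, ∑ μ : Fin d, (((if z' = x + unitVec K μ then (1 : ℝ) else 0)
            + (if z' = x - unitVec K μ then (1 : ℝ) else 0)) * f z') := by
          rw [Finset.mul_sum]
          exact Finset.sum_congr rfl fun z' _ => by rw [mul_assoc, Finset.sum_mul]
      _ = c * ∑ μ : Fin d, ∑ z' : Tor K, (((if z' = x + unitVec K μ then (1 : ℝ) else 0)
            + (if z' = x - unitVec K μ then (1 : ℝ) else 0)) * f z') := by rw [Finset.sum_comm]
      _ = c * ∑ μ : Fin d, (f (x + unitVec K μ) + f (x - unitVec K μ)) := by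
          congr 1
          refine Finset.sum_congr rfl fun μ _ => ?_
          simp only [add_mul, ite_mul, one_mul, zero_mul, Finset.sum_add_distrib, Finset.sum_ite_eq',
            Finset.mem_univ, if_true]
  simp only [Matrix.mulVec, dotProduct, lapF, zero_add, sub_mul, Finset.sum_sub_distrib]
  rw [hdiag, hoff]

/-- the block part of King's operator in the site basis: `Σ_{z′} (Q*Q)(x,z′) f(z′) = L^{−d} Σ_{z′ ∈ B(x)} f(z′)`.
[folklore] -/
theorem blockProj_mulVec (f : Tor (fine L M) → ℝ) (x : Tor (fine L M)) :
    (blockProj L M).mulVec f x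
      = ((L : ℝ) ^ d)⁻¹
          * ∑ k ∈ univ.filter (fun k => B5Blocks16.blockOf L M k = B5Blocks16.blockOf L M x), f k := by
  simp only [Matrix.mulVec, dotProduct, blockProj, ite_mul, zero_mul]
  rw [← Finset.sum_filter, Finset.mul_sum]
  refine Finset.sum_congr ?_ fun _ _ => rfl
  ext k
  simp only [Finset.mem_filter, Finset.mem_univ, true_and, blockOf_eq_blockOf]
  exact eq_comm

/-- **King's one-step operator in the site basis** (`m2 = 0`, any periods):
`(fineOp L M a c 0) f (x) = c Σ_μ (2f(x) − f(x+e_μ) − f(x−e_μ)) + (a/L^d) Σ_{x′ ∈ B(x)} f(x′)`. [folklore] -/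
theorem fineOp_mulVec (a c : ℝ) (f : Tor (fine L M) → ℝ) (x : Tor (fine L M)) :
    (fineOp L M a c 0).mulVec f x
      = c * ∑ μ : Fin d, (2 * f x - f (x + unitVec (fine L M) μ) - f (x - unitVec (fine L M) μ))
        + a / (L : ℝ) ^ d
            * ∑ k ∈ univ.filter (fun k => B5Blocks16.blockOf L M k = B5Blocks16.blockOf L M x), f k := by
  rw [fineOp, Matrix.add_mulVec, Matrix.smul_mulVec, Pi.add_apply, Pi.smul_apply, smul_eq_mul, lapF_mulVec,
    blockProj_mulVec]
  rw [Finset.sum_sub_distrib, Finset.sum_sub_distrib, Finset.sum_add_distrib, Finset.sum_const, Finset.card_univ,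
    Fintype.card_fin]
  simp only [nsmul_eq_mul]
  ring

end Bridge

section G0Bridge

variable (n : ℕ) (M : Fin d → ℕ) [hM : ∀ μ, NeZero (M μ)]

/-- **THE BRIDGE: pv23's `torusOp` IS King's `fineOp` at King scaling `c = (n+1)²`, `m2 = 0`** (periods `≥ 3`).
[folklore] -/
theorem torusOp_eq_fineOp (h3 : ∀ μ, 3 ≤ fine (n + 1) M μ) (a : ℝ) :
    torusOp n M a = fineOp (n + 1) M a ((((n + 1 : ℕ)) : ℝ) ^ 2) 0 := by
  refine eq_of_mulVec_eq fun f => funext fun x => ?_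
  rw [torusOp_mulVec n M h3, fineOp_mulVec]
  push_cast
  ring

/-- **pv23's Green matrix is King's inverse:** `G0 n M a = (fineOp (n+1) M a ((n+1)²) 0)⁻¹`. [folklore] -/
theorem G0_eq_fineOp_inv (h3 : ∀ μ, 3 ≤ fine (n + 1) M μ) (a : ℝ) :
    G0 n M a = (fineOp (n + 1) M a ((((n + 1 : ℕ)) : ℝ) ^ 2) 0)⁻¹ := by
  rw [G0, torusOp_eq_fineOp n M h3]

/-- **(E₀) FOR pv23's `G0`, VERBATIM**: for `a > 0` and periods `≥ 3`,
`G0(x,x′) = GfreePerp (n+1) M 0 (x′ − x) + V⁻¹a⁻¹ − Rperp (n+1) M a 0 x x′` — the massless mean-zero free torus Green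
function of `−Δ^η` (no `p = 0` term), the exact zero mode, minus the Woodbury correction of `WoodburyFibre`. [folklore] -/
theorem G0_decomposition (h3 : ∀ μ, 3 ≤ fine (n + 1) M μ) {a : ℝ} (ha : 0 < a) (x x' : Tor (fine (n + 1) M)) :
    (((G0 n M a x x' : ℝ)) : ℂ)
      = GfreePerp (n + 1) M 0 (x' - x) + ((Fintype.card (Tor (fine (n + 1) M)) : ℂ))⁻¹ * (1 / (a : ℂ))
        - Rperp (n + 1) M a 0 x x' := by
  rw [G0_eq_fineOp_inv n M h3]
  exact fineOp_inv_zero_decomposition (n + 1) M (by omega) ha x x'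

end G0Bridge

section G0Four

variable (n M₀ : ℕ) [NeZero M₀]

/-- **THE WOODBURY BOUNDS FOR pv23's `G0` in `d = 4`** (equal periods `M₀`, fine periods `(n+1)M₀ ≥ 3`, every `a > 0`,
every volume): with `R⊥ := GfreePerp 0 (x′−x) + V⁻¹a⁻¹ − G0(x,x′) = Rperp (n+1) (cM M₀) a 0 x x′`,
`‖R⊥‖ ≤ woodburyD 0/(n+1)⁴`, `‖∇_μ R⊥‖ ≤ woodburyD1 0/(n+1)⁵`, `‖∇_μ∇′_ν R⊥‖ ≤ woodburyD2 0/(n+1)⁶` — i.e. in lattice units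
(`Γ_L = L²G0`, `L = n+1`) the `D₀L⁻²`, `D₁L⁻³`, `D₂L⁻⁴` of RULING (R7)(i) with absolute constants. [folklore] -/
theorem G0_woodbury_bounds {a : ℝ} (ha : 0 < a) (μ ν : Fin 4) (x x' : Tor (fine (n + 1) (cM M₀))) :
    ‖Rperp (n + 1) (cM M₀) a 0 x x'‖ ≤ woodburyD 0 / (((n + 1 : ℕ) : ℝ)) ^ 4
      ∧ ‖dRperp (n + 1) (cM M₀) a 0 μ x x'‖ ≤ woodburyD1 0 / (((n + 1 : ℕ) : ℝ)) ^ 5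
      ∧ ‖ddRperp (n + 1) (cM M₀) a 0 μ ν x x'‖ ≤ woodburyD2 0 / (((n + 1 : ℕ) : ℝ)) ^ 6 :=
  ⟨norm_Rperp_le (n + 1) M₀ (by omega) ha le_rfl x x',
    norm_dRperp_le (n + 1) M₀ (by omega) ha le_rfl μ x x',
    norm_ddRperp_le (n + 1) M₀ (by omega) ha le_rfl μ ν x x'⟩

/-- d = 4 sanity: the bridge hypotheses are jointly satisfiable (`n+1 = 2`, `M₀ = 3`: fine periods `6 ≥ 3`). -/
example : ∀ μ : Fin 4, 3 ≤ fine (1 + 1) (cM 3) μ := by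
  intro μ; show 3 ≤ (1 + 1) * 3; norm_num

end G0Four

end Literature.MathematicalPhysics.QuantumFieldTheory.Balaban1983to89.Beta.WoodburyFibre
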